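import Literature.Probability.LatticeModels.SixVertexPlanarGFFLimit

/-!
# Theorem 53 for the planar measure from the uniform two-point convergence of Theorem 2.8 (1)
# (DKLM 2026, Part II)

H. Duminil-Copin, K. K. Kozlowski, P. Lammers, I. Manolescu, *Gaussian free field convergence of
the six-vertex model with `-1 ≤ Δ ≤ -1/2`*, arXiv:2603.06268 (2026) [DKLM2026SixVertexGFF]
(`paper:arxiv-2603.06268`, chunk p0036):

> **Theorem 53.** […] If `lim_{L→∞} lim_{δ→0} Φ₂^{(δL;δ)}|_K = σ₀² Ψ₂^GFF|_K` where `K` is any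
> compact subset of `𝒟₂` and the convergence is uniform, then […] `μ_GFF`.

`SixVertexPlanarGFFLimit.lean` consumed the two-point convergence through the lattice
approximants of the configurations of two horizontal pairs (`hGFF`). Here we derive that input from
the mode-(1) clause of Theorem 2.8 for `k = 2` as vendored in the statement file — uniform
convergence of `Φ₂^{(δ)} = kPointScaled P 2 δ` to `σ² Ψ₂^GFF` on compact subsets of `𝒟₂` — by
evaluating along the moving points `δ·u_δ` (which converge, together with their limit, inside a
compact subset of `𝒟₂`) and using the continuity and translation invariance of `Ψ₂^GFF`:

* `gffKPoint_two_translate`, `continuousAt_gffKPoint_two_config` (joint continuity; cf. the one-variable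
  `continuousAt_gffKPoint_two` of `SixVertexGFFAsymptotics.lean`), `mem_pairDomain_two_of_re_lt`;
* `tendsto_planarTwoPoint_of_mode1` (`hGFF` from mode (1));
* **`IsPlanarSixVertexMeasure.planar_gffSpectralLimit_of_mode1`** — Theorem 53 for the planar
  measure with hypotheses: Corollary 18 displays, unit-pair decay, and mode (1) for `k = 2`.

## References

* H. Duminil-Copin, K. K. Kozlowski, P. Lammers, I. Manolescu, arXiv:2603.06268 (2026), Part II,
  Theorem 53; Theorem 2.8 (1), Definition 2.7. [DKLM2026SixVertexGFF]
-/

noncomputable section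

open MeasureTheory Set Filter Topology Complex

namespace Literature.Probability.LatticeModels.SixVertex

/-! ## 1. `Ψ₂^GFF`: translation invariance, continuity, and the domain `𝒟₂` -/

/-- `G(x+z, y+z) = G(x,y)`. [cite: DKLM2026SixVertexGFF, Def. 2.6] -/
theorem greenPlane_add_right (x y z : ℂ) : greenPlane (x + z) (y + z) = greenPlane x y := by
  simp [greenPlane]

/-- **Translation invariance of `Ψ₂^GFF`.** [cite: DKLM2026SixVertexGFF, Def. 2.6] -/
theorem gffKPoint_two_translate (u : Fin 2 → ℂ × ℂ) (z : ℂ) :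
    gffKPoint 2 (fun i => ((u i).1 + z, (u i).2 + z)) = gffKPoint 2 u := by
  rw [gffKPoint_two, gffKPoint_two]
  simp only [greenPlane_add_right]

/-- `(x, y) ↦ G(x, y)` is continuous at points with `x ≠ y` (as a function of a configuration).
[cite: DKLM2026SixVertexGFF, Def. 2.6] -/
theorem continuousAt_greenPlane_comp {X : Type*} [TopologicalSpace X] {f g : X → ℂ} {x₀ : X}
    (hf : ContinuousAt f x₀) (hg : ContinuousAt g x₀) (hne : f x₀ ≠ g x₀) :
    ContinuousAt (fun x => greenPlane (f x) (g x)) x₀ := by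
  unfold greenPlane
  refine continuousAt_const.mul ((Real.continuousAt_log ?_).comp ?_)
  · exact (norm_pos_iff.mpr (sub_ne_zero.mpr (Ne.symm hne))).ne'
  · exact continuous_norm.continuousAt.comp (hg.sub hf)

/-- **Joint continuity of `Ψ₂^GFF`** (as a function on `Fin 2 → ℂ × ℂ`) at a configuration whose
four cross differences `u₁ - u₂, u₁ - u₂', u₁' - u₂, u₁' - u₂'` are non-zero — the joint version of
the one-variable `continuousAt_gffKPoint_two` of `SixVertexGFFAsymptotics.lean`.
[cite: DKLM2026SixVertexGFF, Def. 2.6] -/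
theorem continuousAt_gffKPoint_two_config (u₀ : Fin 2 → ℂ × ℂ) (h11 : (u₀ 0).1 ≠ (u₀ 1).1) (h12 : (u₀ 0).1 ≠ (u₀ 1).2)
    (h21 : (u₀ 0).2 ≠ (u₀ 1).1) (h22 : (u₀ 0).2 ≠ (u₀ 1).2) : ContinuousAt (gffKPoint 2) u₀ := by
  have hfun : gffKPoint 2 = fun u : Fin 2 → ℂ × ℂ => greenPlane (u 0).2 (u 1).2 - greenPlane (u 0).1 (u 1).2 -
      greenPlane (u 0).2 (u 1).1 + greenPlane (u 0).1 (u 1).1 := funext fun u => gffKPoint_two u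
  rw [hfun]
  have c01 : Continuous fun u : Fin 2 → ℂ × ℂ => (u 0).1 := continuous_fst.comp (continuous_apply 0)
  have c02 : Continuous fun u : Fin 2 → ℂ × ℂ => (u 0).2 := continuous_snd.comp (continuous_apply 0)
  have c11 : Continuous fun u : Fin 2 → ℂ × ℂ => (u 1).1 := continuous_fst.comp (continuous_apply 1)
  have c12 : Continuous fun u : Fin 2 → ℂ × ℂ => (u 1).2 := continuous_snd.comp (continuous_apply 1)
  exact (((continuousAt_greenPlane_comp c02.continuousAt c12.continuousAt h22).sub
    (continuousAt_greenPlane_comp c01.continuousAt c12.continuousAt h12)).sub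
    (continuousAt_greenPlane_comp c02.continuousAt c11.continuousAt h21)).add
    (continuousAt_greenPlane_comp c01.continuousAt c11.continuousAt h11)

/-- A configuration whose first pair lies strictly to the left of its second pair (real parts) is
in `𝒟₂`. [cite: DKLM2026SixVertexGFF, Def. 2.6 (the domain `𝒟_k`)] -/
theorem mem_pairDomain_two_of_re_lt (u : Fin 2 → ℂ × ℂ)
    (h : max (u 0).1.re (u 0).2.re < min (u 1).1.re (u 1).2.re) : u ∈ pairDomain 2 := by
  have key : ∀ a ∈ ({(u 0).1, (u 0).2} : Set ℂ), ∀ b ∈ ({(u 1).1, (u 1).2} : Set ℂ), a ≠ b := by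
    intro a ha b hb hab
    simp only [mem_insert_iff, mem_singleton_iff] at ha hb
    have ha' : a.re ≤ max (u 0).1.re (u 0).2.re := by
      rcases ha with rfl | rfl
      · exact le_max_left _ _
      · exact le_max_right _ _
    have hb' : min (u 1).1.re (u 1).2.re ≤ b.re := by
      rcases hb with rfl | rfl
      · exact min_le_left _ _
      · exact min_le_right _ _
    rw [hab] at ha'
    linarith
  intro i j hij
  fin_cases i <;> fin_cases j
  · exact absurd rfl hij
  · exact Set.disjoint_left.2 fun a ha hb => key a ha a hb rfl
  · exact Set.disjoint_left.2 fun a ha hb => key a hb a ha rfl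
  · exact absurd rfl hij

/-! ## 2. `hGFF` from mode (1) -/

/-- `latticePt m n = m + n i`. [folklore] -/
theorem latticePt_eq (m n : ℤ) : latticePt m n = (m : ℂ) + (n : ℂ) * I :=
  Complex.ext (by simp [latticePt]) (by simp [latticePt])

/-- Scaling a lattice point: `δ·(p + qi) = δp + δq·i`. [folklore] -/
theorem ofReal_mul_latticePt (δ : ℝ) (p q : ℤ) :
    ((δ : ℂ)) * latticePt p q = ((δ * (p : ℝ) : ℝ) : ℂ) + ((δ * (q : ℝ) : ℝ) : ℂ) * I := by
  rw [latticePt_eq]; push_cast; ring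

/-- `x_n + y_n i → x + y i` from `x_n → x`, `y_n → y` (Mathlib's `Filter.Tendsto.ofReal` for the
casts). [folklore] -/
theorem tendsto_ofReal_add_ofReal_mul_I {f g : ℕ → ℝ} {x y : ℝ} (hf : Tendsto f atTop (𝓝 x)) (hg : Tendsto g atTop (𝓝 y)) :
    Tendsto (fun n => ((f n : ℝ) : ℂ) + ((g n : ℝ) : ℂ) * I) atTop (𝓝 ((x : ℂ) + (y : ℂ) * I)) :=
  hf.ofReal.add (hg.ofReal.mul tendsto_const_nhds)

/-- `δ_n · toNat(z_n) → max(x, 0)` when `δ_n z_n → x` (the vertical offsets `y₀ = (y₁')⁻`, `y₂ = (y₁')⁺`).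
[folklore] -/
theorem tendsto_mul_toNat {δ : ℕ → ℝ} (hδ0 : ∀ n, 0 < δ n) {z : ℕ → ℤ} {x : ℝ}
    (h : Tendsto (fun n => δ n * (z n : ℝ)) atTop (𝓝 x)) :
    Tendsto (fun n => δ n * (((z n).toNat : ℤ) : ℝ)) atTop (𝓝 (max x 0)) := by
  have heq : ∀ n, δ n * (((z n).toNat : ℤ) : ℝ) = max (δ n * (z n : ℝ)) 0 := by
    intro n
    rw [Int.toNat_eq_max, Int.cast_max, Int.cast_zero, mul_max_of_nonneg _ _ (hδ0 n).le, mul_zero]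
  simp_rw [heq]
  exact h.max tendsto_const_nhds

/-- The four points of the configuration behind `planarTwoPoint P x₁ x₁' y₁' x₂` (`x₁, x₂ ≥ 1`).
[cite: DKLM2026SixVertexGFF, Def. 2.4] -/
theorem planarConfig_points (x₁ x₁' : ℕ) (y₁' : ℤ) (x₂ : ℕ) (hx₁ : 1 ≤ x₁) (hx₂ : 1 ≤ x₂) :
    (lPairConfig (x₁ - 1) 0 (x₁ - 1) 0 0 (x₂ - 1) 0 (-y₁').toNat y₁'.toNat x₁' 0).1 = latticePt (-1) ((-y₁').toNat : ℕ) ∧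
    (lPairConfig (x₁ - 1) 0 (x₁ - 1) 0 0 (x₂ - 1) 0 (-y₁').toNat y₁'.toNat x₁' 0).2 =
        latticePt ((x₁ : ℤ) - 1) ((-y₁').toNat : ℕ) ∧
    (lPairConfig (x₁ - 1) 0 (x₁ - 1) 0 0 (x₂ - 1) 0 (-y₁').toNat y₁'.toNat x₁' 1).1 =
        latticePt ((x₁ : ℤ) - 1 + x₁') (y₁'.toNat : ℕ) ∧
    (lPairConfig (x₁ - 1) 0 (x₁ - 1) 0 0 (x₂ - 1) 0 (-y₁').toNat y₁'.toNat x₁' 1).2 =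
        latticePt ((x₁ : ℤ) - 1 + x₁' + x₂) (y₁'.toNat : ℕ) := by
  simp only [lPairConfig, Matrix.cons_val_zero, Matrix.cons_val_one]
  refine ⟨?_, ?_, ?_, ?_⟩
  · congr 1
  · congr 1
    push_cast; omega
  · congr 1
    push_cast; omega
  · congr 1
    push_cast; omega

/-- **`hGFF` from mode (1) for `k = 2`**: if `Φ₂^{(δ)} = kPointScaled P 2 δ → σ² Ψ₂^GFF` uniformly
on compact subsets of `𝒟₂` as `δ → 0⁺`, then the planar two-point function of two horizontal
pairs converges along the lattice approximants of `(m+1, 0, x₁', y₁', x₂, 0)` for every sequence of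
scales `δ_n → 0⁺`. [cite: DKLM2026SixVertexGFF, Theorem 2.8 (1) / Definition 2.7 (1) and Theorem 53] -/
theorem tendsto_planarTwoPoint_of_mode1 {P : Measure (Config (ℤ × ℤ))} {σ : ℝ}
    (hmode1 : ∀ K ⊆ pairDomain 2, IsCompact K →
      TendstoUniformlyOn (fun δ u => kPointScaled P 2 δ u) (fun u => σ ^ 2 * gffKPoint 2 u) (𝓝[>] (0 : ℝ)) K)
    {δ : ℕ → ℝ} (hδ0 : ∀ n, 0 < δ n) (hδ : Tendsto δ atTop (𝓝 0)) (m : ℕ) {x₁' y₁' x₂ : ℝ} (hx₁' : 0 < x₁')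
    (hx₂ : 0 < x₂) :
    Tendsto (fun n => planarTwoPoint P ⌈((m : ℝ) + 1) / δ n⌉₊ ⌈x₁' / δ n⌉₊ ⌊y₁' / δ n⌋ ⌈x₂ / δ n⌉₊) atTop
      (𝓝 (σ ^ 2 * gffKPoint 2 (configOf (m + 1) 0 x₁' y₁' x₂ 0))) := by
  have hm : (0 : ℝ) < (m : ℝ) + 1 := by positivity
  -- lattice approximants
  set kx₁ : ℕ → ℕ := fun n => ⌈((m : ℝ) + 1) / δ n⌉₊ with hkx₁
  set kx₁' : ℕ → ℕ := fun n => ⌈x₁' / δ n⌉₊ with hkx₁'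
  set ky₁' : ℕ → ℤ := fun n => ⌊y₁' / δ n⌋ with hky₁'
  set kx₂ : ℕ → ℕ := fun n => ⌈x₂ / δ n⌉₊ with hkx₂
  obtain ⟨hkx₁t, hX₁⟩ := tendsto_mul_natCeil_div hδ0 hδ hm.le
  obtain ⟨hkx₁'t, hX₀⟩ := tendsto_mul_natCeil_div hδ0 hδ hx₁'.le
  obtain ⟨hkx₂t, hX₂⟩ := tendsto_mul_natCeil_div hδ0 hδ hx₂.le
  have hy : Tendsto (fun n => δ n * (ky₁' n : ℝ)) atTop (𝓝 y₁') := tendsto_mul_intFloor_div hδ0 hδ y₁'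
  have hpos : ∀ (t : ℝ), 0 < t → ∀ n, t ≤ δ n * (⌈t / δ n⌉₊ : ℝ) → 1 ≤ ⌈t / δ n⌉₊ := by
    intro t ht n h1
    by_contra h0
    push Not at h0
    have : ⌈t / δ n⌉₊ = 0 := by omega
    rw [this, Nat.cast_zero, mul_zero] at h1
    linarith
  have hkx₁1 : ∀ n, 1 ≤ kx₁ n := fun n => hpos _ hm n (hX₁ n)
  have hkx₁'1 : ∀ n, 1 ≤ kx₁' n := fun n => hpos _ hx₁' n (hX₀ n)
  have hkx₂1 : ∀ n, 1 ≤ kx₂ n := fun n => hpos _ hx₂ n (hX₂ n)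
  -- the coordinate sequences (in lattice units) and their scaled limits
  have hr₂ : Tendsto (fun n => δ n * ((((kx₁ n : ℤ) - 1 : ℤ) : ℝ))) atTop (𝓝 ((m : ℝ) + 1)) := by
    have := hkx₁t.sub hδ
    rw [sub_zero] at this
    refine this.congr fun n => ?_
    push_cast; ring
  have hr₃ : Tendsto (fun n => δ n * ((((kx₁ n : ℤ) - 1 + kx₁' n : ℤ) : ℝ))) atTop (𝓝 ((m : ℝ) + 1 + x₁')) := by
    have := (hkx₁t.sub hδ).add hkx₁'t
    rw [sub_zero] at this
    refine this.congr fun n => ?_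
    push_cast; ring
  have hr₄ : Tendsto (fun n => δ n * ((((kx₁ n : ℤ) - 1 + kx₁' n + kx₂ n : ℤ) : ℝ))) atTop
      (𝓝 ((m : ℝ) + 1 + x₁' + x₂)) := by
    have := ((hkx₁t.sub hδ).add hkx₁'t).add hkx₂t
    rw [sub_zero] at this
    refine this.congr fun n => ?_
    push_cast; ring
  have hr₁ : Tendsto (fun n => δ n * (((-1 : ℤ) : ℤ) : ℝ)) atTop (𝓝 0) := by
    have := hδ.neg
    rw [neg_zero] at this
    refine this.congr fun n => ?_
    push_cast; ring
  have hs₀ : Tendsto (fun n => δ n * ((((-ky₁' n).toNat : ℕ) : ℤ) : ℝ)) atTop (𝓝 (max (-y₁') 0)) := by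
    have h := tendsto_mul_toNat hδ0 (z := fun n => -ky₁' n) (x := -y₁') (by
      have := hy.neg
      refine this.congr fun n => ?_
      push_cast; ring)
    exact h
  have hs₂ : Tendsto (fun n => δ n * ((((ky₁' n).toNat : ℕ) : ℤ) : ℝ)) atTop (𝓝 (max y₁' 0)) :=
    tendsto_mul_toNat hδ0 hy
  -- configurations
  set C : ℕ → Fin 2 → ℂ × ℂ := fun n =>
    lPairConfig (kx₁ n - 1) 0 (kx₁ n - 1) 0 0 (kx₂ n - 1) 0 (-ky₁' n).toNat (ky₁' n).toNat (kx₁' n) with hC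
  set v : ℕ → Fin 2 → ℂ × ℂ := fun n i => (((δ n : ℝ) : ℂ) * (C n i).1, ((δ n : ℝ) : ℂ) * (C n i).2) with hv
  set Y₀ : ℝ := max (-y₁') 0 with hY₀
  set Y₂ : ℝ := max y₁' 0 with hY₂
  set ut : Fin 2 → ℂ × ℂ := ![(((0 : ℝ) : ℂ) + (Y₀ : ℂ) * I, ((((m : ℝ) + 1 : ℝ) : ℂ)) + (Y₀ : ℂ) * I),
    ((((m : ℝ) + 1 + x₁' : ℝ) : ℂ) + (Y₂ : ℂ) * I, (((m : ℝ) + 1 + x₁' + x₂ : ℝ) : ℂ) + (Y₂ : ℂ) * I)] with hut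
  have hplanar : ∀ n, planarTwoPoint P (kx₁ n) (kx₁' n) (ky₁' n) (kx₂ n) = kPointScaled P 2 (δ n) (v n) := by
    intro n
    rw [planarTwoPoint, kPointScaled]
    congr 1
    funext i
    simp only [hv]
    rw [mul_div_cancel_left₀ _ (Complex.ofReal_ne_zero.2 (hδ0 n).ne'),
      mul_div_cancel_left₀ _ (Complex.ofReal_ne_zero.2 (hδ0 n).ne')]
  -- explicit coordinates of `v n`
  have hvn : ∀ n, v n = ![(((δ n * (((-1 : ℤ) : ℤ) : ℝ) : ℝ) : ℂ) + ((δ n * ((((-ky₁' n).toNat : ℕ) : ℤ) : ℝ) : ℝ) : ℂ) * I,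
      ((δ n * ((((kx₁ n : ℤ) - 1 : ℤ)) : ℝ) : ℝ) : ℂ) + ((δ n * ((((-ky₁' n).toNat : ℕ) : ℤ) : ℝ) : ℝ) : ℂ) * I),
      (((δ n * ((((kx₁ n : ℤ) - 1 + kx₁' n : ℤ)) : ℝ) : ℝ) : ℂ) + ((δ n * ((((ky₁' n).toNat : ℕ) : ℤ) : ℝ) : ℝ) : ℂ) * I,
      ((δ n * ((((kx₁ n : ℤ) - 1 + kx₁' n + kx₂ n : ℤ)) : ℝ) : ℝ) : ℂ) + ((δ n * ((((ky₁' n).toNat : ℕ) : ℤ) : ℝ) : ℝ) : ℂ) * I)] := by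
    intro n
    obtain ⟨e1, e2, e3, e4⟩ := planarConfig_points (kx₁ n) (kx₁' n) (ky₁' n) (kx₂ n) (hkx₁1 n) (hkx₂1 n)
    funext i
    fin_cases i
    · simp only [hv, hC, Fin.zero_eta, Matrix.cons_val_zero]
      rw [e1, e2, ofReal_mul_latticePt, ofReal_mul_latticePt]
    · simp only [hv, hC, Fin.mk_one, Matrix.cons_val_one, Matrix.cons_val_zero]
      rw [e3, e4, ofReal_mul_latticePt, ofReal_mul_latticePt]
  -- `v n → ut`
  have hvt : Tendsto v atTop (𝓝 ut) := by
    rw [tendsto_pi_nhds]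
    intro i
    simp_rw [hvn]
    fin_cases i
    · simp only [hut]
      exact (tendsto_ofReal_add_ofReal_mul_I hr₁ hs₀).prodMk_nhds (tendsto_ofReal_add_ofReal_mul_I hr₂ hs₀)
    · simp only [hut]
      exact (tendsto_ofReal_add_ofReal_mul_I hr₃ hs₂).prodMk_nhds (tendsto_ofReal_add_ofReal_mul_I hr₄ hs₂)
  -- `ut` and the `v n` are in `𝒟₂`
  have hut_mem : ut ∈ pairDomain 2 := by
    refine mem_pairDomain_two_of_re_lt _ ?_
    simp only [hut, Matrix.cons_val_zero, Matrix.cons_val_one, Complex.add_re, Complex.ofReal_re, Complex.mul_re,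
      Complex.I_re, Complex.ofReal_im, Complex.I_im, mul_zero, sub_zero, add_zero, mul_one]
    rw [max_lt_iff, lt_min_iff, lt_min_iff]
    refine ⟨⟨by linarith, by linarith⟩, by linarith, by linarith⟩
  have hv_mem : ∀ n, v n ∈ pairDomain 2 := by
    intro n
    refine mem_pairDomain_two_of_re_lt _ ?_
    rw [hvn n]
    simp only [Matrix.cons_val_zero, Matrix.cons_val_one, Complex.add_re, Complex.ofReal_re, Complex.mul_re,
      Complex.I_re, Complex.ofReal_im, Complex.I_im, mul_zero, sub_zero, add_zero, mul_one]
    have h0 : (0 : ℝ) ≤ (kx₁ n : ℝ) := Nat.cast_nonneg _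
    have h1 : (1 : ℝ) ≤ (kx₁' n : ℝ) := by exact_mod_cast hkx₁'1 n
    have h2 : (1 : ℝ) ≤ (kx₂ n : ℝ) := by exact_mod_cast hkx₂1 n
    have hd := hδ0 n
    rw [max_lt_iff, lt_min_iff, lt_min_iff]
    push_cast
    refine ⟨⟨?_, ?_⟩, ?_, ?_⟩ <;> exact mul_lt_mul_of_pos_left (by linarith) hd
  -- the compact set `K = {ut} ∪ {v n}` and uniform convergence on it
  set K : Set (Fin 2 → ℂ × ℂ) := insert ut (range v) with hK
  have hKc : IsCompact K := hvt.isCompact_insert_range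
  have hKsub : K ⊆ pairDomain 2 := by
    rintro u (rfl | ⟨n, rfl⟩)
    · exact hut_mem
    · exact hv_mem n
  have hunif := hmode1 K hKsub hKc
  have hδw : Tendsto δ atTop (𝓝[>] 0) := tendsto_nhdsWithin_iff.2 ⟨hδ, Eventually.of_forall hδ0⟩
  -- `Ψ^GFF(v n) → Ψ^GFF(ut)` (continuity) and `Ψ^GFF(ut) = Ψ^GFF(configOf …)` (translation)
  have hcont : Tendsto (fun n => σ ^ 2 * gffKPoint 2 (v n)) atTop (𝓝 (σ ^ 2 * gffKPoint 2 ut)) := by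
    refine Tendsto.const_mul _ ((continuousAt_gffKPoint_two_config ut ?_ ?_ ?_ ?_).tendsto.comp hvt) <;>
    · intro h
      have := congrArg Complex.re h
      simp only [hut, Matrix.cons_val_zero, Matrix.cons_val_one, Complex.add_re, Complex.ofReal_re, Complex.mul_re,
        Complex.I_re, Complex.ofReal_im, Complex.I_im, mul_zero, sub_zero, add_zero, mul_one] at this
      linarith
  have htrans : gffKPoint 2 ut = gffKPoint 2 (configOf (m + 1) 0 x₁' y₁' x₂ 0) := by
    rw [← gffKPoint_two_translate (configOf (m + 1) 0 x₁' y₁' x₂ 0) ((Y₀ : ℂ) * I)]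
    congr 1
    funext i
    have hY : (Y₂ : ℝ) = y₁' + Y₀ := by
      simp only [hY₂, hY₀]
      rcases le_total 0 y₁' with h | h
      · rw [max_eq_left h, max_eq_right (by linarith)]; ring
      · rw [max_eq_right h, max_eq_left (by linarith)]; ring
    fin_cases i
    · simp only [hut, configOf]
      ext <;> simp [Complex.ext_iff]
    · simp only [hut, configOf]
      ext <;> simp [Complex.ext_iff, hY]
  -- conclusion: `|kPointScaled (δ n) (v n) - σ²Ψ(v n)| → 0` and `σ²Ψ(v n) → σ²Ψ(configOf …)`
  rw [← htrans]
  have hdiff : Tendsto (fun n => kPointScaled P 2 (δ n) (v n) - σ ^ 2 * gffKPoint 2 (v n)) atTop (𝓝 0) := by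
    rw [Metric.tendsto_nhds]
    intro ε hε
    have h := (Metric.tendstoUniformlyOn_iff.1 hunif ε hε)
    filter_upwards [hδw.eventually h] with n hn
    have := hn (v n) (mem_insert_of_mem _ ⟨n, rfl⟩)
    rw [dist_zero_right, Real.norm_eq_abs]
    rw [Real.dist_eq, abs_sub_comm] at this
    exact this
  have := hdiff.add hcont
  rw [zero_add] at this
  refine (this.congr fun n => ?_).congr fun n => (hplanar n).symm
  ring

/-! ## 3. Theorem 53 for the planar measure from mode (1) -/

/-- **Theorem 53 for the planar slope-zero six-vertex measure, hypothesis in the form of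
Theorem 2.8 (1) for `k = 2`**: with the Corollary 18 displays (`hRa`, `hRb`), the unit-pair decay
(`hdecay`) and the uniform convergence of `Φ₂^{(δ)}` to `σ² Ψ₂^GFF` on compact subsets of `𝒟₂`,
there are a subsequence `L_j` and `μ_∞ ∈ 𝓜` with `μ_{L_j} → μ_∞` and `μ_∞^{(δ_n)} → μ_σ` vaguely for
all scales `δ_n → 0⁺`. [cite: DKLM2026SixVertexGFF, Part II, Theorem 53] -/
theorem IsPlanarSixVertexMeasure.planar_gffSpectralLimit_of_mode1 {c : ℝ} (hc : 0 < c) {P : Measure (Config (ℤ × ℤ))}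
    (hP : IsPlanarSixVertexMeasure 1 1 c P) {Creg creg : ℝ} (hcreg : 0 < creg)
    (hRa : ∀ ℓ m : ℕ, |phiHor c ℓ m| ≤ Creg)
    (hRb : ∀ ℓ m ℓ' : ℕ, 0 < ℓ' → (ℓ' : ℝ) ≤ 8 * ((m : ℝ) + 1) → ℓ' ≤ ℓ + 1 →
      |phiVer c ℓ m ℓ'| ≤ Creg * ((ℓ' : ℝ) / ((m : ℝ) + 1)) ^ creg)
    (hdecay : Tendsto (fun k : ℕ => planarTwoPoint P 1 k 0 1) atTop (𝓝 0)) (σ : ℝ)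
    (hmode1 : ∀ K ⊆ pairDomain 2, IsCompact K →
      TendstoUniformlyOn (fun δ u => kPointScaled P 2 δ u) (fun u => σ ^ 2 * gffKPoint 2 u) (𝓝[>] (0 : ℝ)) K) :
    ∃ (φ : ℕ → ℕ) (μinf : Measure (ℝ × ℝ)), StrictMono φ ∧ μinf ∈ dklmSpaceM creg (dklmRegConst Creg creg) ∧
      HalfPlaneVagueTendsto (fun j => dklmMeasure c hc (φ j)) μinf ∧
      ∀ (δ' : ℕ → ℝ), (∀ n, 0 < δ' n) → Tendsto δ' atTop (𝓝 0) →
        HalfPlaneVagueTendsto (fun n => scaleMeasure (δ' n) μinf) (gffSpectralMeasure σ) :=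
  hP.planar_gffSpectralLimit hc hcreg hRa hRb hdecay σ fun _ hδ0 hδ m _ _ _ hx₁' hx₂ =>
    tendsto_planarTwoPoint_of_mode1 hmode1 hδ0 hδ m hx₁' hx₂

end Literature.Probability.LatticeModels.SixVertex

end
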